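import Mathlib.FieldTheory.IntermediateField.Adjoin.Basic
import Literature.NumberTheory.Transcendental.RoyRankGenericApparatus
import HarnessLib

/-!
# Roy 1992 over a general field: admissible maps, rational maps and the number field of `Z`

Support file (linear algebra only, everything proved, no facts) for the deduction of Roy's
Theorem 4 from his Theorem 2 over the general data `(K, F, L)` of
`Literature.NumberTheory.Transcendental.RoyRankGenericDefs` ([Roy1992], §4 pp. 34–37, in the
generality of §4 Remark (i), p. 37). It is the field-generic form of the `K = ℂ` companion
`Literature.Barriers.Schanuel.AlgebraicIndependenceOfLogarithmsThm4FromThm2A` (same statements and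
proofs with `ℂ ↦ K`, `ℚ̄ ↦ F`), on top of `…RoyRankGenericApparatus` (morphisms are products,
`exists_eq_prodMap_of_isBiRational`) and of the ALREADY generic dictionary `F^n ⊂ K^n` of
`Literature.Barriers.Schanuel.AlgebraicIndependenceOfLogarithmsRationalLemmas` (`Roy1992.incl`,
`spanK`, `fPoints`, `map_mulVec_incl`, …), which is imported and reused:

* `RoyRank.exists_eq_prodMap_of_isAdmissible` — an admissible `s` (surjective,
  `s(F^{d₀} × 0) ⊆ F^{d₀'} × 0`, `s(0 × ℚ^{d₁}) ⊆ 0 × ℚ^{d₁'}`) is a product `s₀ × s₁` of a map given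
  by a matrix over `F` and one given by a matrix over `ℚ`, both surjective ("The above conditions on
  `s` show that its kernel is a product `S₀ × S₁`, where `S₀` is a subspace of `K^d` which is
  rational over `ℚ̄`, and where `S₁` is a subspace of `(K^d)^m` which is rational over `ℚ`", p. 35).
* `RoyRank.isRationalMap_mulVecLin_map`, `RoyRank.exists_eq_mulVecLin_of_isRationalMap` — maps
  `K^n → K^m` rational over `F` are exactly the maps given by matrices over `F`.
* `RoyRank.exists_numberField_basis` — "Since `Z` is of finite dimension over `ℚ̄`, there exist a
  subfield `k` of `ℚ̄` of finite degree over `ℚ` and a `k`-vector subspace `Z₁` of `(k + k·L)^d`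
  such that `Z = ℚ̄·Z₁`" (p. 35): for `F` algebraic over `ℚ` (hypothesis `hF`), a finite-dimensional `F`-subspace
  `Z ⊆ (F + F·L)^d` has an `F`-basis with all entries in `k + k·L = span_k ({1} ∪ L)` for some
  intermediate field `k ⊆ F` of finite degree over `ℚ`.

## References

* [Roy1992] D. Roy, *Matrices whose coefficients are linear forms in logarithms*, J. Number Theory
  41 (1992) 22–47: §4, proof of Theorem 4, p. 35; Remark (i), p. 37.
-/

noncomputable section

open Module Submodule
open Literature.Barriers.Schanuel.Roy1992 (incl incl_apply map_mulVec_incl)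

namespace Literature.NumberTheory.Transcendental.RoyRank

variable {K : Type*} [Field K] [CharZero K]
variable (F : IntermediateField ℚ K) (L : Submodule ℚ K)

/-! ### Admissible maps are products of an `F`-rational and a `ℚ`-rational map -/

/-- **Admissible maps are products** (the first step of (5), p. 35): if
`s : K^{d₀} × K^{d₁} → K^{d₀'} × K^{d₁'}` is admissible (`IsAdmissible F s`), then `s = s₀ × s₁` with
`s₀` given by a matrix over `F`, `s₁` by a matrix over `ℚ`, both surjective.
[cite: Roy1992, §4 proof of Theorem 4 (p. 35)] -/
theorem exists_eq_prodMap_of_isAdmissible {d₀ d₁ d₀' d₁' : ℕ}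
    {s : LinTangent K d₀ d₁ →ₗ[K] LinTangent K d₀' d₁'} (hs : IsAdmissible F s) :
    ∃ (A₀ : Matrix (Fin d₀') (Fin d₀) F) (A₁ : Matrix (Fin d₁') (Fin d₁) ℚ),
      s = (A₀.map (algebraMap F K)).mulVecLin.prodMap (A₁.map (algebraMap ℚ K)).mulVecLin ∧
      Function.Surjective (A₀.map (algebraMap F K)).mulVecLin ∧
      Function.Surjective (A₁.map (algebraMap ℚ K)).mulVecLin := by
  obtain ⟨A₀, A₁, hdec⟩ := exists_eq_prodMap_of_isBiRational hs.2
  refine ⟨A₀, A₁, hdec, fun a => ?_, fun b => ?_⟩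
  · obtain ⟨⟨x, y⟩, hxy⟩ := hs.1 (a, 0)
    refine ⟨x, ?_⟩
    have := congrArg Prod.fst hxy
    rwa [hdec, LinearMap.prodMap_apply] at this
  · obtain ⟨⟨x, y⟩, hxy⟩ := hs.1 (0, b)
    refine ⟨y, ?_⟩
    have := congrArg Prod.snd hxy
    rwa [hdec, LinearMap.prodMap_apply] at this

/-! ### Maps rational over `F` are the maps given by matrices over `F` -/

/-- The matrix of a map `K^{d₁} → K^{d₂}` rational over `F` has entries in `F`. [folklore] -/
theorem toMatrix'_mem_of_isRationalMap {d₁ d₂ : ℕ} {t : (Fin d₁ → K) →ₗ[K] (Fin d₂ → K)}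
    (ht : IsRationalMap F t) (i : Fin d₂) (j : Fin d₁) : LinearMap.toMatrix' t i j ∈ F := by
  rw [LinearMap.toMatrix'_apply]
  refine ht _ (fun k => ?_) i
  by_cases h : k = j
  · subst h; simp
  · simp [h]

/-- A map given by a matrix with entries in `F` is rational over `F`. [folklore] -/
theorem isRationalMap_mulVecLin_map {m n : ℕ} (A : Matrix (Fin m) (Fin n) F) :
    IsRationalMap F (A.map (algebraMap F K)).mulVecLin := by
  intro v hv j
  let v₀ : Fin n → F := fun i => ⟨v i, hv i⟩
  have hv₀ : v = incl F K n v₀ := funext fun i => rfl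
  rw [hv₀, map_mulVec_incl, incl_apply]
  exact SetLike.coe_mem _

/-- A map rational over `F` is given by a matrix with entries in `F`. [folklore] -/
theorem exists_eq_mulVecLin_of_isRationalMap {m n : ℕ} {t : (Fin n → K) →ₗ[K] (Fin m → K)}
    (ht : IsRationalMap F t) :
    ∃ A : Matrix (Fin m) (Fin n) F, t = (A.map (algebraMap F K)).mulVecLin := by
  refine ⟨fun i j => ⟨LinearMap.toMatrix' t i j, toMatrix'_mem_of_isRationalMap F ht i j⟩, ?_⟩
  have h : (Matrix.map (fun i j => (⟨LinearMap.toMatrix' t i j, toMatrix'_mem_of_isRationalMap F ht i j⟩ : F))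
      (algebraMap F K)) = LinearMap.toMatrix' t := by
    ext i j; rfl
  rw [h, ← Matrix.toLin'_apply', Matrix.toLin'_toMatrix']

/-- A map given by a matrix over `F` maps `(F + F·L)^n` into `(F + F·L)^m` (`F + F·L` is an
`F`-vector space). [folklore] -/
theorem mulVec_map_mem_linForms {m n : ℕ} (A : Matrix (Fin m) (Fin n) F) {z : Fin n → K}
    (hz : ∀ i, z i ∈ linForms F L) (j : Fin m) :
    (A.map (algebraMap F K)).mulVec z j ∈ linForms F L := by
  rw [Matrix.mulVec, dotProduct]
  refine sum_mem fun i _ => ?_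
  have h : algebraMap F K (A j i) * z i = (A j i) • z i := by
    rw [IntermediateField.smul_def, smul_eq_mul]; rfl
  rw [Matrix.map_apply, h]
  exact Submodule.smul_mem _ _ (hz i)

omit [CharZero K] in
/-- A surjection onto `K^{d₁}` with `d₁ > 0` is non-zero. [folklore] -/
theorem ne_zero_of_surjective {d d₁ : ℕ} (hd₁ : 0 < d₁) {t : (Fin d → K) →ₗ[K] (Fin d₁ → K)}
    (ht : Function.Surjective t) : t ≠ 0 := by
  intro h
  obtain ⟨w, hw⟩ := ht fun _ => 1
  have := congrFun hw ⟨0, hd₁⟩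
  simp [h] at this

omit [CharZero K] in
/-- A non-zero map to `K^{d₁}` has `d₁ > 0`. [folklore] -/
theorem pos_of_ne_zero {d d₁ : ℕ} {t : (Fin d → K) →ₗ[K] (Fin d₁ → K)} (ht : t ≠ 0) : 0 < d₁ := by
  rcases Nat.eq_zero_or_pos d₁ with rfl | h
  · exact absurd (LinearMap.ext fun v => funext fun i => Fin.elim0 i) ht
  · exact h

/-! ### The number field of a finite-dimensional `F`-subspace of `(F + F·L)^d` -/

/-- **The number field of `Z`** ("there exist a subfield `k` of `ℚ̄` of finite degree over `ℚ` and a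
`k`-vector subspace `Z₁` of `(k + k·L)^d` such that `Z = ℚ̄·Z₁`", p. 35): if `F` is algebraic over
`ℚ` (every element of `F` is algebraic, hypothesis `hF`), then for a finite-dimensional `F`-subspace `Z` of `(F + F·L)^d` there are an intermediate field
`k ⊆ F` of finite degree over `ℚ` and an `F`-basis of `Z` all of whose entries lie in
`k + k·L = span_k ({1} ∪ L)` (adjoin to `ℚ` the finitely many coefficients, in `F`, of the entries of
a basis). [cite: Roy1992, §4 proof of Theorem 4 (p. 35)] -/
theorem exists_numberField_basis (hF : ∀ x : K, x ∈ F → IsAlgebraic ℚ x) {d : ℕ}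
    (Z : Submodule F (Fin d → K)) [Module.Finite F Z] (hZ : ∀ z ∈ Z, ∀ i, z i ∈ linForms F L) :
    ∃ (k : IntermediateField ℚ K) (_ : FiniteDimensional ℚ k) (_ : k ≤ F)
      (b : Basis (Fin (finrank F Z)) F Z),
      ∀ r i, (b r : Fin d → K) i ∈ Submodule.span k ({1} ∪ (L : Set K)) := by
  let b : Basis (Fin (finrank F Z)) F Z := finBasis F Z
  have hmem : ∀ r i, (b r : Fin d → K) i ∈ linForms F L := fun r i => hZ _ (b r).2 i
  simp only [linForms, Submodule.mem_span_iff_exists_finset_subset] at hmem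
  choose f t ht hsupp hsum using hmem
  -- the finitely many coefficients, all in `F`
  let C : Set K := ⋃ r, ⋃ i, (fun a => (f r i a : K)) '' (t r i : Set K)
  have hC : C.Finite := Set.finite_iUnion fun r => Set.finite_iUnion fun i =>
    (Finset.finite_toSet _).image _
  haveI : Finite C := hC.to_subtype
  have hCF : C ⊆ F := by
    intro x hx
    simp only [C, Set.mem_iUnion, Set.mem_image] at hx
    obtain ⟨r, i, a, -, rfl⟩ := hx
    exact SetLike.coe_mem _
  have hCint : ∀ x ∈ C, IsIntegral ℚ x := by
    intro x hx
    simp only [C, Set.mem_iUnion, Set.mem_image] at hx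
    obtain ⟨r, i, a, -, rfl⟩ := hx
    exact (hF _ (SetLike.coe_mem (f r i a))).isIntegral
  let k : IntermediateField ℚ K := IntermediateField.adjoin ℚ C
  haveI hk : FiniteDimensional ℚ k := IntermediateField.finiteDimensional_adjoin hCint
  have hkF : k ≤ F := IntermediateField.adjoin_le_iff.2 hCF
  refine ⟨k, hk, hkF, b, fun r i => ?_⟩
  rw [← hsum r i]
  refine Submodule.sum_mem _ fun a ha => ?_
  have hfa : (f r i a : K) ∈ k :=
    IntermediateField.subset_adjoin ℚ C (Set.mem_iUnion.2 ⟨r, Set.mem_iUnion.2 ⟨i, a, ha, rfl⟩⟩)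
  have hsmul : f r i a • a = (⟨(f r i a : K), hfa⟩ : k) • a := by
    rw [IntermediateField.smul_def, IntermediateField.smul_def]
  rw [hsmul]
  exact Submodule.smul_mem _ _ (Submodule.subset_span (ht r i ha))

/-- Elements of an intermediate field `k ⊆ F` lie in `F`. [folklore] -/
theorem mem_of_mem_of_le {k : IntermediateField ℚ K} (hkF : k ≤ F) {x : K} (hx : x ∈ k) : x ∈ F :=
  hkF hx

end Literature.NumberTheory.Transcendental.RoyRank
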